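import Literature.Geometry.ComplexAnalytic.HolomorphicMorseLemma
import Literature.Analysis.Complex.HadamardDivisionPartial
import HarnessLib

/-!
# The holomorphic Hadamard lemma of second order RELATIVE to a coordinate axis (first half of the holomorphic
# splitting lemma / Morse lemma with parameters)

Layer `Literature/Geometry/ComplexAnalytic`; theorems only. Written by the prover seat `hodge-nonav-prover-Bx` (g16, cell
`hodge-nonav`) as brick B4a of the programme «A₃-TRACE» (crux K1-B of `Summits/HodgeConjecture/HodgeConjecture/Theses/SignSymmetricPowers.lean`,
stmt-HodgeConjecture-19716): the SPLITTING LEMMA (AGZV I §9.3 / Ebeling Prop. 3.13: at a critical point with Hessian of corank one,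
`f ∼ ρ(u) + Σ wⱼ²` with `u` the kernel coordinate) is the Morse lemma in the coordinates `w` with `u` as a holomorphic PARAMETER; its
first step is Hadamard's division by the `w`-coordinates only.

Coordinates: `E = Fin (m + 2) → ℂ`, the parameter `u = z (Fin.last (m + 1))`, the variables `wᵢ = z i.castSucc`
(`Fin.init z`); the AXIS is `{w = 0} = {Fin.snoc 0 u}`.

* `exists_eq_sum_mul_mul_rel` — if `F` is holomorphic on the polydisc `‖z‖ < r`, vanishes on the axis, and its `w`-partials vanish on
  the axis, then `F z = Σᵢⱼ wᵢ wⱼ hᵢⱼ(z)` with `hᵢⱼ` holomorphic on the polydisc (tree `SCV.exists_eq_sum_smul_of_forall_apply_killCoords_eq_zero`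
  twice; `gᵢ = 0` on the axis by differentiating `F = Σ wₖ gₖ` there);
* `exists_bilinForm_eq_rel` — hence `F z = R_z(w, w)` for a holomorphic map `R` into the symmetric bilinear forms of the `w`-space,
  and `d²F(0)(w̃, w̃') = 2 R_0(w, w')` on the `w`-space (`w̃ = Fin.snoc w 0`; second derivative along the complex lines `t ↦ t w̃`).

## References

* [Milnor1963] J. Milnor, *Morse theory*, Lemma 2.1 and proof of Lemma 2.2.
* [ArnoldGuseinZadeVarchenko1985] V. I. Arnold, S. M. Gusein-Zade, A. N. Varchenko, *Singularities of Differentiable Maps* I,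
  §9.3–§9.6 (the splitting lemma / parametric Morse lemma), §11.1.
* [Ebeling2007] W. Ebeling, *Functions of Several Complex Variables and Their Singularities*, Prop. 3.12–3.13.
-/

noncomputable section

open Set Function Filter Module Metric
open scoped Topology ContDiff

-- Instance search through the tower `V →L[ℂ] V →L[ℂ] ℂ` needs one more level of pending depth (as in `HolomorphicMorseLemma`).
set_option maxSynthPendingDepth 2

namespace Literature.Geometry.ComplexAnalytic

namespace HolomorphicSplitting

variable {m : ℕ}

/-! ### Coordinates -/

/-- The biorthogonality of the coordinate system `(Pi.single i 1, proj i)` of `Fin N → ℂ`. [folklore] -/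
private theorem proj_single {N : ℕ} (i j : Fin N) :
    (ContinuousLinearMap.proj (R := ℂ) (φ := fun _ : Fin N => ℂ) i) (Pi.single j (1 : ℂ) : Fin N → ℂ) =
      if i = j then 1 else 0 := by
  simp only [ContinuousLinearMap.proj_apply, Pi.single_apply]

/-- The product domain of the coordinate projections centred at `0` is the sup-norm ball. [folklore] -/
private theorem setOf_proj_mem_ball_eq {N : ℕ} {r : ℝ} (hr : 0 < r) :
    {z : Fin N → ℂ | ∀ i, (ContinuousLinearMap.proj (R := ℂ) (φ := fun _ : Fin N => ℂ) i) (z - 0) ∈ ball (0 : ℂ) r} =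
      ball (0 : Fin N → ℂ) r := by
  ext z
  simp only [mem_setOf_eq, sub_zero, ContinuousLinearMap.proj_apply, mem_ball, dist_zero_right]
  exact (pi_norm_lt_iff hr).symm

/-- Killing the `w`-coordinates (`castSucc`) of `z` leaves the axis point `Fin.snoc 0 (z last)`. [folklore] -/
private theorem sub_sum_castSucc_eq_snoc (z : Fin (m + 2) → ℂ) :
    z - ∑ i ∈ (Finset.univ : Finset (Fin (m + 1))).map Fin.castSuccEmb,
        (ContinuousLinearMap.proj (R := ℂ) (φ := fun _ : Fin (m + 2) => ℂ) i) (z - 0) • (Pi.single i (1 : ℂ) : Fin (m + 2) → ℂ) =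
      Fin.snoc (0 : Fin (m + 1) → ℂ) (z (Fin.last (m + 1))) := by
  rw [Finset.sum_map]
  funext k
  simp only [Pi.sub_apply, Finset.sum_apply, Pi.smul_apply, ContinuousLinearMap.proj_apply, sub_zero, smul_eq_mul,
    Fin.castSuccEmb_apply, Pi.single_apply]
  refine Fin.lastCases ?_ (fun j => ?_) k
  · rw [Fin.snoc_last]
    have h : ∀ x : Fin (m + 1), z x.castSucc * (if Fin.last (m + 1) = x.castSucc then (1 : ℂ) else 0) = 0 := fun x => by
      rw [if_neg (Fin.castSucc_lt_last x).ne', mul_zero]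
    rw [Finset.sum_congr rfl fun x _ => h x, Finset.sum_const_zero, sub_zero]
  · rw [Fin.snoc_castSucc, Pi.zero_apply, Finset.sum_eq_single j (fun x _ hx => by
        rw [if_neg (fun h => hx (Fin.castSucc_injective _ h).symm), mul_zero]) (fun h => absurd (Finset.mem_univ j) h),
      if_pos rfl, mul_one, sub_self]

/-- The axis point has norm at most `‖z‖`. [folklore] -/
private theorem norm_snoc_zero_le (z : Fin (m + 2) → ℂ) : ‖(Fin.snoc (0 : Fin (m + 1) → ℂ) (z (Fin.last (m + 1))) : Fin (m + 2) → ℂ)‖ ≤ ‖z‖ := by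
  refine (pi_norm_le_iff_of_nonneg (norm_nonneg z)).2 fun k => ?_
  refine Fin.lastCases ?_ (fun j => ?_) k
  · rw [Fin.snoc_last]; exact norm_le_pi_norm z _
  · rw [Fin.snoc_castSucc, Pi.zero_apply, norm_zero]; exact norm_nonneg _

/-! ### Hadamard of second order relative to the axis -/

/-- **Holomorphic Hadamard lemma of second order, relative to the axis `{w = 0}`.** If `F` is holomorphic on the polydisc
`‖z‖ < r` of `Fin (m + 2) → ℂ`, vanishes on the axis `{Fin.snoc 0 u}` and has vanishing `w`-partials there, then
`F z = Σᵢⱼ wᵢ wⱼ hᵢⱼ(z)` (`wᵢ = z i.castSucc`) with `hᵢⱼ` holomorphic on the polydisc.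
[cite: Milnor1963, Lemma 2.1 and proof of Lemma 2.2] [cite: ArnoldGuseinZadeVarchenko1985, §9.3] -/
theorem exists_eq_sum_mul_mul_rel {r : ℝ} (hr : 0 < r) {F : (Fin (m + 2) → ℂ) → ℂ} (hF : DifferentiableOn ℂ F (ball 0 r))
    (hax : ∀ z ∈ ball (0 : Fin (m + 2) → ℂ) r, F (Fin.snoc (0 : Fin (m + 1) → ℂ) (z (Fin.last (m + 1)))) = 0)
    (hcrit : ∀ z ∈ ball (0 : Fin (m + 2) → ℂ) r, ∀ i : Fin (m + 1),
      fderiv ℂ F (Fin.snoc (0 : Fin (m + 1) → ℂ) (z (Fin.last (m + 1)))) (Pi.single i.castSucc 1) = 0) :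
    ∃ h : Fin (m + 1) → Fin (m + 1) → (Fin (m + 2) → ℂ) → ℂ, (∀ i j, DifferentiableOn ℂ (h i j) (ball 0 r)) ∧
      ∀ z ∈ ball (0 : Fin (m + 2) → ℂ) r, F z = ∑ i, ∑ j, z i.castSucc * z j.castSucc * h i j z := by
  classical
  set e : Fin (m + 2) → (Fin (m + 2) → ℂ) := fun i => Pi.single i 1 with he
  set ℓ : Fin (m + 2) → (Fin (m + 2) → ℂ) →L[ℂ] ℂ := fun i => ContinuousLinearMap.proj i with hℓ
  have hdual : ∀ i j, ℓ i (e j) = if i = j then 1 else 0 := fun i j => proj_single i j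
  have hP := setOf_proj_mem_ball_eq (N := m + 2) hr
  have hD : ∀ _i : Fin (m + 2), IsOpen (ball (0 : ℂ) r) := fun _ => isOpen_ball
  have hD0 : ∀ _i : Fin (m + 2), (0 : ℂ) ∈ ball (0 : ℂ) r := fun _ => mem_ball_self hr
  set s : Finset (Fin (m + 2)) := (Finset.univ : Finset (Fin (m + 1))).map Fin.castSuccEmb with hs
  have hπ : ∀ z : Fin (m + 2) → ℂ, z - ∑ i ∈ s, ℓ i (z - 0) • e i = Fin.snoc (0 : Fin (m + 1) → ℂ) (z (Fin.last (m + 1))) :=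
    fun z => sub_sum_castSucc_eq_snoc z
  have haxP : ∀ z ∈ ball (0 : Fin (m + 2) → ℂ) r,
      (Fin.snoc (0 : Fin (m + 1) → ℂ) (z (Fin.last (m + 1))) : Fin (m + 2) → ℂ) ∈ ball (0 : Fin (m + 2) → ℂ) r := by
    intro z hz
    rw [mem_ball, dist_zero_right] at hz ⊢
    exact lt_of_le_of_lt (norm_snoc_zero_le z) hz
  -- first division
  have hF' : DifferentiableOn ℂ F {z : Fin (m + 2) → ℂ | ∀ i, ℓ i (z - 0) ∈ ball (0 : ℂ) r} := by rwa [hP]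
  obtain ⟨g, hg, hFg⟩ := Literature.Analysis.Complex.SCV.exists_eq_sum_smul_of_forall_apply_killCoords_eq_zero e ℓ
    hdual 0 (fun _ => ball (0 : ℂ) r) hD hD0 hF' s (fun z hz => by rw [hπ]; rw [hP] at hz; exact hax z hz)
  rw [hP] at hg hFg
  -- second division, for each `gᵢ`
  have hg2 := fun i => Literature.Analysis.Complex.SCV.exists_eq_apply_killCoords_add_sum_smul e ℓ hdual 0
    (fun _ => ball (0 : ℂ) r) hD hD0 (f := g i) (by rw [hP]; exact hg i) s
  choose h hh' hgh' using hg2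
  have hh : ∀ i j, DifferentiableOn ℂ (h i j) (ball 0 r) := fun i j =>
    (hh' i j).mono fun z hz => (Set.ext_iff.1 hP z).2 hz
  have hgh : ∀ i, ∀ z ∈ ball (0 : Fin (m + 2) → ℂ) r,
      g i z = g i (Fin.snoc (0 : Fin (m + 1) → ℂ) (z (Fin.last (m + 1)))) + ∑ j ∈ s, ℓ j (z - 0) • h i j z :=
    fun i z hz => by rw [← hπ z]; exact hgh' i z ((Set.ext_iff.1 hP z).2 hz)
  -- `gᵢ = 0` on the axis for `i ∈ s`, from the vanishing of the `w`-partials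
  have hg0 : ∀ i : Fin (m + 1), ∀ z ∈ ball (0 : Fin (m + 2) → ℂ) r,
      g i.castSucc (Fin.snoc (0 : Fin (m + 1) → ℂ) (z (Fin.last (m + 1)))) = 0 := by
    intro i z hz
    set a' : Fin (m + 2) → ℂ := Fin.snoc (0 : Fin (m + 1) → ℂ) (z (Fin.last (m + 1))) with ha'
    have ha'ball : a' ∈ ball (0 : Fin (m + 2) → ℂ) r := haxP z hz
    have hball : ball (0 : Fin (m + 2) → ℂ) r ∈ 𝓝 a' := isOpen_ball.mem_nhds ha'ball
    have ha's : ∀ k ∈ s, a' k = 0 := by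
      intro k hk
      obtain ⟨j, -, rfl⟩ := Finset.mem_map.1 hk
      rw [Fin.castSuccEmb_apply, ha', Fin.snoc_castSucc, Pi.zero_apply]
    -- derivative of `Σ_{k ∈ s} z_k g_k z` at `a'`
    have hderiv : HasFDerivAt (fun y : Fin (m + 2) → ℂ => ∑ k ∈ s, ℓ k (y - 0) • g k y)
        (∑ k ∈ s, (a' k • fderiv ℂ (g k) a' + g k a' • ℓ k)) a' := by
      have hsum : HasFDerivAt (fun y : Fin (m + 2) → ℂ => ∑ k ∈ s, y k * g k y)
          (∑ k ∈ s, (a' k • fderiv ℂ (g k) a' + g k a' • ℓ k)) a' := by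
        refine HasFDerivAt.fun_sum fun k _ => ?_
        have hgk : HasFDerivAt (g k) (fderiv ℂ (g k) a') a' := ((hg k).differentiableAt hball).hasFDerivAt
        exact (hasFDerivAt_apply k a').mul hgk
      have e1 : (fun y : Fin (m + 2) → ℂ => ∑ k ∈ s, ℓ k (y - 0) • g k y) = fun y => ∑ k ∈ s, y k * g k y := by
        funext y; simp [hℓ]
      rw [e1]; exact hsum
    have hFd : HasFDerivAt F (∑ k ∈ s, (a' k • fderiv ℂ (g k) a' + g k a' • ℓ k)) a' := by
      refine hderiv.congr_of_eventuallyEq ?_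
      filter_upwards [hball] with y hy
      exact hFg y hy
    have h1 : fderiv ℂ F a' (e i.castSucc) = 0 := hcrit z hz i
    rw [hFd.fderiv] at h1
    simp only [FunLike.coe_sum, Finset.sum_apply, add_apply,
      FunLike.coe_smul, Pi.smul_apply, smul_eq_mul, hdual] at h1
    rw [Finset.sum_eq_single_of_mem (i.castSucc : Fin (m + 2)) (Finset.mem_map_of_mem _ (Finset.mem_univ i))
      (fun k hk hki => by rw [ha's k hk, zero_mul, if_neg hki, mul_zero, add_zero])] at h1
    have ha'i : a' i.castSucc = 0 := by rw [ha', Fin.snoc_castSucc]; rfl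
    rw [ha'i, zero_mul, zero_add, if_pos rfl, mul_one] at h1
    exact h1
  refine ⟨fun i j => h i.castSucc j.castSucc, fun i j => hh _ _, fun z hz => ?_⟩
  rw [hFg z hz, Finset.sum_map]
  refine Finset.sum_congr rfl fun i _ => ?_
  rw [Fin.castSuccEmb_apply, hgh i.castSucc z hz, hg0 i z hz, zero_add, Finset.smul_sum, Finset.sum_map]
  refine Finset.sum_congr rfl fun j _ => ?_
  simp only [hℓ, ContinuousLinearMap.proj_apply, sub_zero, smul_eq_mul, Fin.castSuccEmb_apply]
  ring

/-- **The second derivative along a complex line** (copy of the tree's private lemma of `HolomorphicMorseLemma`): if `F` is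
holomorphic on the polydisc `‖z‖ < r`, `dF(0) = 0`, `d(dF)(0) = L`, and `F (t • w) = t² q(t)` near `t = 0` with `q`
holomorphic, then `L w w = 2 q(0)`. [folklore] -/
private theorem apply_apply_eq_two_mul {N : ℕ} {r : ℝ} {f : (Fin N → ℂ) → ℂ}
    (hf : DifferentiableOn ℂ f (ball 0 r)) (h1 : fderiv ℂ f 0 = 0) {L : (Fin N → ℂ) →L[ℂ] (Fin N → ℂ) →L[ℂ] ℂ}
    (h2 : HasFDerivAt (fderiv ℂ f) L 0) (w : Fin N → ℂ) {δ : ℝ} (hδ : 0 < δ)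
    (hδr : ∀ t : ℂ, ‖t‖ < δ → t • w ∈ ball (0 : Fin N → ℂ) r) {q : ℂ → ℂ}
    (hq : DifferentiableOn ℂ q (ball 0 δ)) (hfq : ∀ t : ℂ, ‖t‖ < δ → f (t • w) = t ^ 2 * q t) :
    L w w = 2 * q 0 := by
  set φ : ℂ → ℂ := fun t => (fderiv ℂ f (t • w)) w with hφ
  have hline : ∀ t : ℂ, HasDerivAt (fun t : ℂ => t • w) w t := fun t => by
    simpa using (hasDerivAt_id t).smul_const w
  have hφ' : HasDerivAt φ (L w w) 0 := by
    have hk : HasDerivAt (fun t : ℂ => fderiv ℂ f (t • w)) (L w) 0 := by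
      have h2' : HasFDerivAt (fderiv ℂ f) L ((0 : ℂ) • w) := by rwa [zero_smul]
      exact h2'.comp_hasDerivAt 0 (hline 0)
    have h := hk.clm_apply (hasDerivAt_const (0 : ℂ) w)
    simpa using h
  have hφ0 : φ 0 = 0 := by simp [hφ, h1]
  have hqa : AnalyticOnNhd ℂ q (ball 0 δ) := hq.analyticOnNhd isOpen_ball
  have hφeq : ∀ t : ℂ, ‖t‖ < δ → φ t = 2 * t * q t + t ^ 2 * deriv q t := by
    intro t ht
    have htball : t ∈ ball (0 : ℂ) δ := by rwa [mem_ball, dist_zero_right]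
    have hF1 : HasDerivAt (fun t : ℂ => f (t • w)) (φ t) t := by
      have hfd : HasFDerivAt f (fderiv ℂ f (t • w)) (t • w) :=
        (hf.differentiableAt (isOpen_ball.mem_nhds (hδr t ht))).hasFDerivAt
      exact hfd.comp_hasDerivAt t (hline t)
    have hq' : HasDerivAt q (deriv q t) t := (hq.differentiableAt (isOpen_ball.mem_nhds htball)).hasDerivAt
    have hF2 : HasDerivAt (fun t : ℂ => t * t * q t) ((1 * t + t * 1) * q t + t * t * deriv q t) t :=
      ((hasDerivAt_id t).mul (hasDerivAt_id t)).mul hq'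
    have hF2' : HasDerivAt (fun t : ℂ => f (t • w)) ((1 * t + t * 1) * q t + t * t * deriv q t) t := by
      refine hF2.congr_of_eventuallyEq ?_
      have hev : ∀ᶠ s in 𝓝 t, ‖s‖ < δ := by
        have : ball (0 : ℂ) δ ∈ 𝓝 t := isOpen_ball.mem_nhds htball
        filter_upwards [this] with s hs
        rwa [mem_ball, dist_zero_right] at hs
      filter_upwards [hev] with s hs
      rw [hfq s hs, pow_two]
    rw [hF1.unique hF2']
    ring
  have hslope := hφ'.tendsto_slope_zero
  simp only [zero_add, hφ0, sub_zero, smul_eq_mul] at hslope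
  have hcont : ContinuousAt (fun t : ℂ => 2 * q t + t * deriv q t) 0 := by
    have hq0 : ContinuousAt q 0 := (hqa 0 (mem_ball_self hδ)).continuousAt
    have hq1 : ContinuousAt (deriv q) 0 := (hqa.deriv 0 (mem_ball_self hδ)).continuousAt
    exact (continuousAt_const.mul hq0).add (continuousAt_id.mul hq1)
  have hlim2 : Tendsto (fun t : ℂ => t⁻¹ * φ t) (𝓝[≠] 0) (𝓝 (2 * q 0 + 0 * deriv q 0)) := by
    refine (hcont.tendsto.mono_left nhdsWithin_le_nhds).congr' ?_
    have hev : ∀ᶠ t in 𝓝[≠] (0 : ℂ), t ≠ 0 ∧ ‖t‖ < δ := by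
      have h1 : ∀ᶠ t in 𝓝[≠] (0 : ℂ), t ≠ 0 := self_mem_nhdsWithin
      have h2 : ∀ᶠ t in 𝓝[≠] (0 : ℂ), ‖t‖ < δ := by
        have : ball (0 : ℂ) δ ∈ 𝓝[≠] (0 : ℂ) := mem_nhdsWithin_of_mem_nhds (isOpen_ball.mem_nhds (mem_ball_self hδ))
        filter_upwards [this] with t ht
        rwa [mem_ball, dist_zero_right] at ht
      exact h1.and h2
    filter_upwards [hev] with t ht
    obtain ⟨ht0, htδ⟩ := ht
    rw [hφeq t htδ]
    have e1 : t⁻¹ * (2 * t * q t + t ^ 2 * deriv q t) = (t⁻¹ * t) * (2 * q t + t * deriv q t) := by ring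
    rw [e1, inv_mul_cancel₀ ht0, one_mul]
  rw [zero_mul, add_zero] at hlim2
  exact tendsto_nhds_unique hslope hlim2

/-- **Relative Hadamard, bilinear-form version, with the second derivative on the `w`-space.** For `F` holomorphic on the
polydisc `‖z‖ < r` of `Fin (m + 2) → ℂ`, vanishing on the axis with vanishing `w`-partials there, `dF(0) = 0` and
`d(dF)(0) = L`: there is a holomorphic map `R` into the symmetric bilinear forms of the `w`-space `Fin (m + 1) → ℂ` with
`F z = R_z(w, w)` (`w = Fin.init z`) on the polydisc and `L(w̃, w̃') = 2 R_0(w, w')` for `w̃ = Fin.snoc w 0`.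
[cite: Milnor1963, Lemma 2.1 and proof of Lemma 2.2] [cite: ArnoldGuseinZadeVarchenko1985, §9.3] -/
theorem exists_bilinForm_eq_rel {r : ℝ} (hr : 0 < r) {F : (Fin (m + 2) → ℂ) → ℂ} (hF : DifferentiableOn ℂ F (ball 0 r))
    (hax : ∀ z ∈ ball (0 : Fin (m + 2) → ℂ) r, F (Fin.snoc (0 : Fin (m + 1) → ℂ) (z (Fin.last (m + 1)))) = 0)
    (hcrit : ∀ z ∈ ball (0 : Fin (m + 2) → ℂ) r, ∀ i : Fin (m + 1),
      fderiv ℂ F (Fin.snoc (0 : Fin (m + 1) → ℂ) (z (Fin.last (m + 1)))) (Pi.single i.castSucc 1) = 0)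
    (h1 : fderiv ℂ F 0 = 0) {L : (Fin (m + 2) → ℂ) →L[ℂ] (Fin (m + 2) → ℂ) →L[ℂ] ℂ} (h2 : HasFDerivAt (fderiv ℂ F) L 0) :
    ∃ R : (Fin (m + 2) → ℂ) → ((Fin (m + 1) → ℂ) →L[ℂ] (Fin (m + 1) → ℂ) →L[ℂ] ℂ),
      DifferentiableOn ℂ R (ball 0 r) ∧ (∀ z u v, R z u v = R z v u) ∧
      (∀ z ∈ ball (0 : Fin (m + 2) → ℂ) r, F z = R z (Fin.init z) (Fin.init z)) ∧
      ∀ u v : Fin (m + 1) → ℂ, L (Fin.snoc u 0) (Fin.snoc v 0) = 2 * R 0 u v := by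
  classical
  obtain ⟨h, hh, hFh⟩ := exists_eq_sum_mul_mul_rel hr hF hax hcrit
  let Bf : Fin (m + 1) → Fin (m + 1) → ((Fin (m + 1) → ℂ) →L[ℂ] (Fin (m + 1) → ℂ) →L[ℂ] ℂ) := fun i j =>
    (ContinuousLinearMap.proj (R := ℂ) (φ := fun _ : Fin (m + 1) => ℂ) i).smulRight
      (ContinuousLinearMap.proj (R := ℂ) (φ := fun _ : Fin (m + 1) => ℂ) j)
  have hBf : ∀ i j (u v : Fin (m + 1) → ℂ), Bf i j u v = u i * v j := fun i j u v => by
    simp [Bf, ContinuousLinearMap.smulRight_apply]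
  let R : (Fin (m + 2) → ℂ) → ((Fin (m + 1) → ℂ) →L[ℂ] (Fin (m + 1) → ℂ) →L[ℂ] ℂ) := fun z =>
    ∑ i, ∑ j, (2⁻¹ * (h i j z + h j i z)) • Bf i j
  have hRapply : ∀ z u v, R z u v = ∑ i, ∑ j, 2⁻¹ * (h i j z + h j i z) * (u i * v j) := by
    intro z u v
    simp only [R, FunLike.coe_sum, Finset.sum_apply, FunLike.coe_smul, Pi.smul_apply, hBf,
      smul_eq_mul]
  have hRsymm : ∀ z u v, R z u v = R z v u := by
    intro z u v
    rw [hRapply, hRapply, Finset.sum_comm]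
    refine Finset.sum_congr rfl fun i _ => Finset.sum_congr rfl fun j _ => ?_
    ring
  have hdiag : ∀ (z : Fin (m + 2) → ℂ) (w : Fin (m + 1) → ℂ), R z w w = ∑ i, ∑ j, w i * w j * h i j z := by
    intro z w
    rw [hRapply]
    have hswap : ∑ i, ∑ j, h j i z * (w i * w j) = ∑ i, ∑ j, h i j z * (w i * w j) := by
      rw [Finset.sum_comm]
      exact Finset.sum_congr rfl fun i _ => Finset.sum_congr rfl fun j _ => by ring
    have : ∑ i, ∑ j, 2⁻¹ * (h i j z + h j i z) * (w i * w j) =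
        2⁻¹ * (∑ i, ∑ j, h i j z * (w i * w j)) + 2⁻¹ * (∑ i, ∑ j, h j i z * (w i * w j)) := by
      rw [Finset.mul_sum, Finset.mul_sum, ← Finset.sum_add_distrib]
      refine Finset.sum_congr rfl fun i _ => ?_
      rw [Finset.mul_sum, Finset.mul_sum, ← Finset.sum_add_distrib]
      refine Finset.sum_congr rfl fun j _ => ?_
      ring
    rw [this, hswap, ← add_mul]
    norm_num
    exact Finset.sum_congr rfl fun i _ => Finset.sum_congr rfl fun j _ => by ring
  refine ⟨R, ?_, hRsymm, fun z hz => by rw [hdiag, hFh z hz]; rfl, ?_⟩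
  · show DifferentiableOn ℂ (fun z => ∑ i, ∑ j, (2⁻¹ * (h i j z + h j i z)) • Bf i j) (ball 0 r)
    refine DifferentiableOn.fun_sum fun i _ => DifferentiableOn.fun_sum fun j _ => ?_
    exact (((hh i j).add (hh j i)).const_mul (2⁻¹ : ℂ)).smul_const (Bf i j)
  · -- `L (w̃) (w̃) = 2 R 0 w w` along the complex lines `t ↦ t • w̃`
    have hquad : ∀ w : Fin (m + 1) → ℂ, L (Fin.snoc w 0) (Fin.snoc w 0) = 2 * R 0 w w := by
      intro w
      set W : Fin (m + 2) → ℂ := Fin.snoc w 0 with hW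
      obtain ⟨δ, hδ, hδr⟩ : ∃ δ : ℝ, 0 < δ ∧ ∀ t : ℂ, ‖t‖ < δ → t • W ∈ ball (0 : Fin (m + 2) → ℂ) r := by
        refine ⟨r / (‖W‖ + 1), by positivity, fun t ht => ?_⟩
        rw [mem_ball, dist_zero_right, norm_smul]
        have hw : 0 < ‖W‖ + 1 := by positivity
        calc ‖t‖ * ‖W‖ ≤ ‖t‖ * (‖W‖ + 1) := by gcongr; linarith
          _ < r / (‖W‖ + 1) * (‖W‖ + 1) := by gcongr
          _ = r := div_mul_cancel₀ r hw.ne'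
      set q : ℂ → ℂ := fun t => ∑ i, ∑ j, w i * w j * h i j (t • W) with hq
      have hqd : DifferentiableOn ℂ q (ball 0 δ) := by
        refine DifferentiableOn.fun_sum fun i _ => DifferentiableOn.fun_sum fun j _ => ?_
        refine (differentiableOn_const _).mul ?_
        refine (hh i j).comp ((differentiableOn_id).smul_const W) fun t ht => ?_
        rw [mem_ball, dist_zero_right] at ht
        exact hδr t ht
      have hinit : ∀ t : ℂ, Fin.init (t • W) = t • w := fun t => by
        funext i
        simp [Fin.init, hW, Fin.snoc_castSucc]
      have hfq : ∀ t : ℂ, ‖t‖ < δ → F (t • W) = t ^ 2 * q t := by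
        intro t ht
        rw [hFh _ (hδr t ht), hq, Finset.mul_sum]
        refine Finset.sum_congr rfl fun i _ => ?_
        rw [Finset.mul_sum]
        refine Finset.sum_congr rfl fun j _ => ?_
        have hi : (t • W) i.castSucc = t * w i := by simp [hW, Fin.snoc_castSucc]
        have hj : (t • W) j.castSucc = t * w j := by simp [hW, Fin.snoc_castSucc]
        rw [hi, hj]
        ring
      have hL := apply_apply_eq_two_mul hF h1 h2 W hδ hδr hqd hfq
      rw [hL, hq]
      simp only [zero_smul]
      rw [hdiag]
    -- polarization (both sides symmetric)
    have hball : ball (0 : Fin (m + 2) → ℂ) r ∈ 𝓝 (0 : Fin (m + 2) → ℂ) := isOpen_ball.mem_nhds (mem_ball_self hr)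
    have hLsymm : ∀ u v, L u v = L v u := by
      refine fun u v => second_derivative_symmetric_of_eventually (f := F) (f' := fderiv ℂ F) ?_ h2 u v
      filter_upwards [hball] with y hy
      exact (hF.differentiableAt (isOpen_ball.mem_nhds hy)).hasFDerivAt
    intro u v
    have hsnoc : (Fin.snoc (u + v) 0 : Fin (m + 2) → ℂ) = Fin.snoc u 0 + Fin.snoc v 0 := by
      funext k
      refine Fin.lastCases ?_ (fun j => ?_) k
      · simp [Fin.snoc_last]
      · simp [Fin.snoc_castSucc]
    have huv := hquad (u + v)
    have hu := hquad u
    have hv := hquad v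
    rw [hsnoc] at huv
    simp only [map_add, add_apply] at huv
    rw [hLsymm (Fin.snoc v 0) (Fin.snoc u 0), hRsymm 0 v u] at huv
    linear_combination (2⁻¹ : ℂ) * huv - (2⁻¹ : ℂ) * hu - (2⁻¹ : ℂ) * hv

end HolomorphicSplitting

end Literature.Geometry.ComplexAnalytic

end
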